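import Summits.QuantumFields.YangMills.Theorems.FluctuationComparisonRegPrIntLS2BetaPairingTangentSplit
import HarnessLib

/-!
# S2β ∕ GAP♯∘ strata residue (H′) — INSIDE «CRIT♮»: the pair-form criticality letter from the multiplier form, the multiplier size and the
# second-order fibre defect (sub-door), plus the SIZE of the explicit first variation (proved)

Cell `ym3-torus` (YM ladder rung R3 = continuum `SU(2)` Yang–Mills on the three-torus — a RUNG: NOT d = 4, NOT infinite volume,
NOT a mass gap, NOT Clay).  Width seat «width 16» `ym3-torus-px16` (gen 21), FREE px helper on crux `stmt-QuantumFields-20520`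
(`FluctuationComparisonRegPrIntL`), count-neutral, DEFINITION-FREE, default heartbeats.

WHAT.  The door of record for (F♮) (✓∕⧗`…S2BetaPairingOfTangentLetters.pairingLetter_of_critPair`) consumes ONE analytic letter «CRIT♮»:
`|DA(U₀)[ξ(U,U₀)]| ≤ C_c·θ_J·(N⁻²·d² + REL)` for argmin ∕ fibre pairs, `DA(U₀)` the EXPLICIT first variation of ✓`…PairingTangentSplit`.
This file supplies (UV3-NODE §75.8 (3)):
* §1 `abs_firstVariation_le_curl` (`|DA(U₀)[ζ]| ≤ θ₀·Σ_p ‖(curl_{U₀}ζ)_p‖` — the form MULT♮ uses on smooth right inverses) and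
  ★ `abs_firstVariation_le` — **THE SIZE OF THE FIRST VARIATION, PROVED**: `|DA(U₀)[ζ]| ≤ 4d·θ₀·Σ_ℓ ‖ζ_ℓ‖` for every tangent field `ζ`
  (`‖a_p‖ ≤ θ₀`, `Ad` isometric, slot double counting ✓`sum_slots_le`) — the kinematic half of MULT♮ (`λ = DA∘R` is as small as `DA` times
  the norm of a right inverse `R` of the linearised descent);
* §2 ★ `multiplier_of_rightInverse` — plain-function algebra: DA constant on the fibres of `DM` (constrained criticality, set form) + a right
  inverse `R` with `nX(Rv) ≤ C_R·nY v` + `|DA ζ| ≤ C_A·θ₀·nX ζ` ⟹ `λ := DA∘R` has `DA = λ∘DM` and `|λ v| ≤ C_A·θ₀·C_R·nY v`;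
* §3 ★★★ `critPair_of_multiplier (G) (hMult)` — THE SUB-DOOR: «CRIT♮» (text of the door of record VERBATIM, guard `G`) ⟸ «MULT♭»: same prefix,
  `∃ γ₁ > 0, ∃ C_λ C_M ≥ 0, ∀ F γ … ∀ U₀ ∈ argmin, ∃ DM λ, (∀ ζ, DA(U₀)[ζ] = λ (DM ζ))` (CRIT-m♮) `∧ (∀ v, |λ v| ≤ C_λ·θ_J·N⁻¹·Σ_B ‖v_B‖)` (MULT♮)
  `∧ ∀ U ∈ fibre ∩ histGood, Σ_B ‖(DM ξ)_B‖ ≤ C_M·(N⁻¹·d² + N·REL)` (AVG₂♭ — the `N·REL` slack admits rough, tower-adjacent fibre chords);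
  then `|DA ξ| = |λ(DM ξ)| ≤ C_λC_M·θ_J·(N⁻²·d² + REL)` (`N⁻¹·N = 1`).  `DM` is meant to be the linearised `(K−J)`-fold descent at `U₀` in the
  right-invariant chart; here it is `∃`-bound together with `λ` (the three conjuncts are ONE letter «MULT♭» until a holder pins `DM`).

HONEST SCOPE.  §1–§2 are theorems (kinematics ∕ algebra); «MULT♭» and «CRIT♮» are HYPOTHESIS texts; nothing of Bałaban's analysis is asserted
or proved; (F♮), (D♮), `hIrr`, `hA`, GAP♯∘ (`stub_uniformFibreGapOrbit`), S2β, the five registered stubs of `Lines/semiclassical_s2beta.lean`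
(3732b7df), crux 20520, 19936, 19200 and `YM3TorusSU2` are NOT proved; no registered stub is closed; the Yang–Mills mass gap is NOT proved.
Sorry-free, axioms standard.

References: T. Bałaban, CMP **102** (1985) 277–309 [Balaban1985Variational] (Thm 1 (8)–(10) p.279; (34) p.283); CMP **109** (1987) 249–301
[Balaban1987RG1] ((0.21)–(0.22) p.256); CMP **122** (1989) 175–202 [Balaban1989LargeFieldI] ((1.77) p.194); CMP **102** (1985) 255–275
[Balaban1985UV3] ((7) p.257).
-/

set_option autoImplicit false

noncomputable section

open scoped Quaternion RealInnerProductSpace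
open Finset
open Literature.MathematicalPhysics.QuantumLattice (su2Quat norm_su2Quat)
open Literature.MathematicalPhysics.QuantumFieldTheory.Balaban1983to89
open Literature.MathematicalPhysics.QuantumFieldTheory.Balaban1983to89.T4CubeChartGnomonic (SU2)
open Literature.MathematicalPhysics.QuantumFieldTheory.Balaban1983to89.T4Continuum
open Literature.MathematicalPhysics.QuantumFieldTheory.Balaban1983to89.T3ContinuumYM3Torus
open Literature.MathematicalPhysics.QuantumFieldTheory.Balaban1983to89.T3UnitLawDensityEML (ℰp)
open Literature.MathematicalPhysics.QuantumFieldTheory.Balaban1983to89.T3UnitScaleTilt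
open Literature.MathematicalPhysics.QuantumFieldTheory.Balaban1983to89.T3TiltDescent
open Literature.MathematicalPhysics.QuantumFieldTheory.Balaban1983to89.T3ConstrainedMinimiser (fibre)
open Literature.MathematicalPhysics.QuantumFieldTheory.Balaban1983to89.T3PrintedRegularMinimiser
open Literature.MathematicalPhysics.QuantumFieldTheory.Balaban1983to89.T3MinimiserStabilityReduction (θBal_pos)
open Literature.MathematicalPhysics.QuantumFieldTheory.Balaban1983to89.T4ExpWindowSmallField (imVec)
open Literature.MathematicalPhysics.QuantumFieldTheory.Balaban1983to89.B15Prop1ChartSU2 (adSU2)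
open Summit.QuantumFields.YangMills.Theorems.FluctuationComparisonRegPrIntLS2BetaPairingTangentSplit (sum_slots_le)

namespace Summit.QuantumFields.YangMills.Theorems.FluctuationComparisonRegPrIntLS2BetaCritPairOfMultiplier

/-! ## §1 The size of the explicit first variation -/

section Size

variable {P : Params} {j : ℕ}

/-- `Ad_T` does not increase the norm (it is an isometry of `ℝ³`; `≤` is all that is used). [cite: Balaban1989LargeFieldI, (1.77) p.194] -/
theorem norm_adSU2_le (T : SU2) (X : EuclideanSpace ℝ (Fin 3)) : ‖adSU2 T X‖ ≤ ‖X‖ := by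
  rw [← T4HaarSU2ExpChart.norm_imQuat (adSU2 T X), B15Prop1ChartCalculusSU2.imQuat_adSU2, norm_mul, norm_mul, norm_inv, norm_su2Quat,
    T4HaarSU2ExpChart.norm_imQuat]
  simp

/-- ★ **THE FIRST VARIATION IS THE PAIRING WITH THE COVARIANT CURL — CURL FORM OF ITS SIZE**: `|DA(U₀)[ζ]| ≤ θ₀·Σ_p ‖(curl_{U₀} ζ)_p‖`,
`(curl_{U₀} ζ)_p := Ad_{T₁}ζ_{ℓ₁} + Ad_{T₂}ζ_{ℓ₂} − Ad_{T₃}ζ_{ℓ₃} − ζ_{ℓ₄}` — the bound MULT♮ actually uses: on a covariantly-spread right inverse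
`R v` the curl lives on the column boundary (`~ N` per unit of `‖v‖₁`), giving `|DA(R v)| ≲ θ₀·N·‖v‖₁ ≲ θ_J·N⁻¹·‖v‖₁`. [cite: Balaban1985Variational, Thm 1 (9) p.279, (34) p.283] -/
theorem abs_firstVariation_le_curl (U₀ : GaugeField P j SU2) {θ₀ : ℝ} (hθ : ∀ p : Plaq P j, dist1 (GaugeField.plaqHol U₀ p) ≤ θ₀)
    (ζ : PBond P j → EuclideanSpace ℝ (Fin 3)) :
    |∑ p : Plaq P j, inner ℝ (imVec (su2Quat (GaugeField.plaqHol U₀ p)))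
        (adSU2 (GaugeField.plaqHol U₀ p)⁻¹ (ζ ⟨p.src, p.μ⟩) + adSU2 ((GaugeField.plaqHol U₀ p)⁻¹ * U₀ ⟨p.src, p.μ⟩) (ζ ⟨p.src.shift p.μ, p.ν⟩) -
          adSU2 ((GaugeField.plaqHol U₀ p)⁻¹ * U₀ ⟨p.src, p.μ⟩ * U₀ ⟨p.src.shift p.μ, p.ν⟩ * (U₀ ⟨p.src.shift p.ν, p.μ⟩)⁻¹) (ζ ⟨p.src.shift p.ν, p.μ⟩) -
          ζ ⟨p.src, p.ν⟩)| ≤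
      θ₀ * ∑ p : Plaq P j, ‖adSU2 (GaugeField.plaqHol U₀ p)⁻¹ (ζ ⟨p.src, p.μ⟩) + adSU2 ((GaugeField.plaqHol U₀ p)⁻¹ * U₀ ⟨p.src, p.μ⟩) (ζ ⟨p.src.shift p.μ, p.ν⟩) -
          adSU2 ((GaugeField.plaqHol U₀ p)⁻¹ * U₀ ⟨p.src, p.μ⟩ * U₀ ⟨p.src.shift p.μ, p.ν⟩ * (U₀ ⟨p.src.shift p.ν, p.μ⟩)⁻¹) (ζ ⟨p.src.shift p.ν, p.μ⟩) -
          ζ ⟨p.src, p.ν⟩‖ := by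
  refine (abs_sum_le_sum_abs _ _).trans ?_
  rw [mul_sum]
  refine sum_le_sum fun p _ => (abs_real_inner_le_norm _ _).trans ?_
  exact mul_le_mul_of_nonneg_right ((CovariantDischargeDirectionNet.norm_imVec_le_dist1 _).trans (hθ p)) (norm_nonneg _)

/-- ★ **THE SIZE OF THE EXPLICIT FIRST VARIATION**: `|DA(U₀)[ζ]| ≤ 4·d·θ₀·Σ_ℓ ‖ζ_ℓ‖` when `dist1 U₀(∂p) ≤ θ₀` — every plaquette term is
`⟪a_p, ·⟫` with `‖a_p‖ ≤ θ₀` against four rotated bond entries, and each bond sits in at most `4d` (plaquette, slot) pairs (§4).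
[cite: Balaban1985Variational, Thm 1 (9) p.279, (34) p.283] -/
theorem abs_firstVariation_le (U₀ : GaugeField P j SU2) {θ₀ : ℝ} (hθ0 : 0 ≤ θ₀) (hθ : ∀ p : Plaq P j, dist1 (GaugeField.plaqHol U₀ p) ≤ θ₀)
    (ζ : PBond P j → EuclideanSpace ℝ (Fin 3)) :
    |∑ p : Plaq P j, inner ℝ (imVec (su2Quat (GaugeField.plaqHol U₀ p)))
        (adSU2 (GaugeField.plaqHol U₀ p)⁻¹ (ζ ⟨p.src, p.μ⟩) + adSU2 ((GaugeField.plaqHol U₀ p)⁻¹ * U₀ ⟨p.src, p.μ⟩) (ζ ⟨p.src.shift p.μ, p.ν⟩) -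
          adSU2 ((GaugeField.plaqHol U₀ p)⁻¹ * U₀ ⟨p.src, p.μ⟩ * U₀ ⟨p.src.shift p.μ, p.ν⟩ * (U₀ ⟨p.src.shift p.ν, p.μ⟩)⁻¹) (ζ ⟨p.src.shift p.ν, p.μ⟩) -
          ζ ⟨p.src, p.ν⟩)| ≤
      4 * P.d * θ₀ * ∑ ℓ : PBond P j, ‖ζ ℓ‖ := by
  classical
  refine (abs_sum_le_sum_abs _ _).trans ?_
  have hstep : ∀ p : Plaq P j, |inner ℝ (imVec (su2Quat (GaugeField.plaqHol U₀ p)))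
        (adSU2 (GaugeField.plaqHol U₀ p)⁻¹ (ζ ⟨p.src, p.μ⟩) + adSU2 ((GaugeField.plaqHol U₀ p)⁻¹ * U₀ ⟨p.src, p.μ⟩) (ζ ⟨p.src.shift p.μ, p.ν⟩) -
          adSU2 ((GaugeField.plaqHol U₀ p)⁻¹ * U₀ ⟨p.src, p.μ⟩ * U₀ ⟨p.src.shift p.μ, p.ν⟩ * (U₀ ⟨p.src.shift p.ν, p.μ⟩)⁻¹) (ζ ⟨p.src.shift p.ν, p.μ⟩) -
          ζ ⟨p.src, p.ν⟩)| ≤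
      θ₀ * (‖ζ ⟨p.src, p.μ⟩‖ + ‖ζ ⟨p.src.shift p.μ, p.ν⟩‖ + ‖ζ ⟨p.src.shift p.ν, p.μ⟩‖ + ‖ζ ⟨p.src, p.ν⟩‖) := by
    intro p
    refine (abs_real_inner_le_norm _ _).trans ?_
    have ha : ‖imVec (su2Quat (GaugeField.plaqHol U₀ p))‖ ≤ θ₀ := (CovariantDischargeDirectionNet.norm_imVec_le_dist1 _).trans (hθ p)
    have hL : ‖adSU2 (GaugeField.plaqHol U₀ p)⁻¹ (ζ ⟨p.src, p.μ⟩) + adSU2 ((GaugeField.plaqHol U₀ p)⁻¹ * U₀ ⟨p.src, p.μ⟩) (ζ ⟨p.src.shift p.μ, p.ν⟩) -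
          adSU2 ((GaugeField.plaqHol U₀ p)⁻¹ * U₀ ⟨p.src, p.μ⟩ * U₀ ⟨p.src.shift p.μ, p.ν⟩ * (U₀ ⟨p.src.shift p.ν, p.μ⟩)⁻¹) (ζ ⟨p.src.shift p.ν, p.μ⟩) -
          ζ ⟨p.src, p.ν⟩‖ ≤ ‖ζ ⟨p.src, p.μ⟩‖ + ‖ζ ⟨p.src.shift p.μ, p.ν⟩‖ + ‖ζ ⟨p.src.shift p.ν, p.μ⟩‖ + ‖ζ ⟨p.src, p.ν⟩‖ := by
      refine (norm_sub_le _ _).trans (add_le_add ((norm_sub_le _ _).trans (add_le_add ((norm_add_le _ _).trans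
        (add_le_add (norm_adSU2_le _ _) (norm_adSU2_le _ _))) (norm_adSU2_le _ _))) le_rfl)
    exact mul_le_mul ha hL (norm_nonneg _) hθ0
  refine (sum_le_sum fun p _ => hstep p).trans ?_
  rw [← mul_sum]
  have hs := sum_slots_le (fun ℓ : PBond P j => ‖ζ ℓ‖) fun _ => norm_nonneg _
  calc _ ≤ θ₀ * (4 * P.d * ∑ ℓ : PBond P j, ‖ζ ℓ‖) := mul_le_mul_of_nonneg_left hs hθ0
    _ = 4 * P.d * θ₀ * ∑ ℓ : PBond P j, ‖ζ ℓ‖ := by ring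

end Size

/-! ## §2 The multiplier from a right inverse (plain-function algebra) -/

/-- ★★ **THE MULTIPLIER FROM A RIGHT INVERSE** (plain functions; no linearity used): if the first variation `DA` is CONSTANT ON THE FIBRES of
the linearised descent `DM` (constrained criticality, set-theoretic form), `R` is a right inverse of `DM` with `nX (R v) ≤ C_R·nY v`, and
`|DA ζ| ≤ C_A·θ₀·nX ζ`, then `λ := DA ∘ R` represents `DA = λ ∘ DM` with `|λ v| ≤ C_A·θ₀·C_R·nY v` — the multiplier form (CRIT-m♮) AND the
multiplier size (MULT♮) of UV3-NODE §75.8 (3) from {CRIT₀, RINV, DA-size}. [cite: Balaban1987RG1, (0.21)-(0.22) p.256; Balaban1985Variational, Thm 1 (8)-(10) p.279] -/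
theorem multiplier_of_rightInverse {X Y : Type*} (DA : X → ℝ) (DM : X → Y) (R : Y → X) (nX : X → ℝ) (nY : Y → ℝ)
    {C_A C_R θ₀ : ℝ} (hCA : 0 ≤ C_A) (hθ0 : 0 ≤ θ₀)
    (hcrit : ∀ ζ ζ' : X, DM ζ = DM ζ' → DA ζ = DA ζ') (hR : ∀ v : Y, DM (R v) = v) (hRn : ∀ v : Y, nX (R v) ≤ C_R * nY v)
    (hA : ∀ ζ : X, |DA ζ| ≤ C_A * θ₀ * nX ζ) :
    ∃ lam : Y → ℝ, (∀ ζ : X, DA ζ = lam (DM ζ)) ∧ ∀ v : Y, |lam v| ≤ C_A * θ₀ * C_R * nY v := by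
  refine ⟨fun v => DA (R v), fun ζ => hcrit ζ (R (DM ζ)) (hR (DM ζ)).symm, fun v => ?_⟩
  calc |DA (R v)| ≤ C_A * θ₀ * nX (R v) := hA (R v)
    _ ≤ C_A * θ₀ * (C_R * nY v) := mul_le_mul_of_nonneg_left (hRn v) (mul_nonneg hCA hθ0)
    _ = C_A * θ₀ * C_R * nY v := by ring


/-! ## §3 The sub-door: «CRIT♮» (pair form) from «MULT♭» = CRIT-m♮ ∧ MULT♮ ∧ AVG₂♭ -/

/-- ★★★ **«CRIT♮» FROM THE MULTIPLIER FORM, THE MULTIPLIER SIZE AND THE SECOND-ORDER FIBRE DEFECT.**  Conclusion = the `hCrit` input of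
✓∕⧗`…S2BetaPairingOfTangentLetters.pairingLetter_of_critPair` VERBATIM (guard `G`); hypothesis «MULT♭» as displayed in the file header.
[cite: Balaban1987RG1, (0.21)-(0.22) p.256; Balaban1985Variational, Thm 1 (8)-(10) p.279, (34) p.283; Balaban1985UV3, (7) p.257] -/
theorem critPair_of_multiplier
    (G : (F : T3Family) → (J : ℕ) → GaugeField (F.P J) 0 (Matrix.specialUnitaryGroup (Fin 2) ℂ) → Prop)
    (hMult : ∀ (L : ℕ), ∃ c₀ : ℝ, 0 < c₀ ∧ c₀ ≤ 1 ∧ ∀ (cw : ℝ), 0 < cw → cw ≤ c₀ → ∃ pS : ℝ, ∀ (b₀ p₀ : ℝ), 0 < b₀ → pS ≤ p₀ → 0 < p₀ → ∃ ε₁ : ℝ, 0 < ε₁ ∧ ∀ (ε₀ : ℝ), 0 < ε₀ → ε₀ ≤ ε₁ →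
    ∃ γ₁ : ℝ, 0 < γ₁ ∧ ∃ C_lam : ℝ, 0 ≤ C_lam ∧ ∃ C_M : ℝ, 0 ≤ C_M ∧ ∀ (F : T3Family) (γ : ℝ), F.L = L → 0 < γ → γ ≤ γ₁ →
      ∀ (J K : ℕ) (hJK : J ≤ K) (V : GaugeField (F.P J) 0 (Matrix.specialUnitaryGroup (Fin 2) ℂ)), PlaqSmall (θBal F.L γ (cw * b₀) p₀ J) V →
        G F J V →
        ∀ U₀ ∈ {U' : GaugeField (F.P K) 0 (Matrix.specialUnitaryGroup (Fin 2) ℂ) | U' ∈ fibre F ℰp J K hJK V ∧ U' ∈ histGood F ℰp (θBal F.L γ b₀ p₀) K J ∧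
            wilsonAction4 U' = minActionRegPr F J K hJK ε₀ V},
        ∃ (DM : (PBond (F.P K) 0 → EuclideanSpace ℝ (Fin 3)) → (PBond (F.P J) 0 → EuclideanSpace ℝ (Fin 3)))
          (lam : (PBond (F.P J) 0 → EuclideanSpace ℝ (Fin 3)) → ℝ),
          (∀ ζ : PBond (F.P K) 0 → EuclideanSpace ℝ (Fin 3),
            (∑ p : Plaq (F.P K) 0, inner ℝ (imVec (su2Quat (GaugeField.plaqHol U₀ p)))
              (adSU2 (GaugeField.plaqHol U₀ p)⁻¹ (ζ ⟨p.src, p.μ⟩) + adSU2 ((GaugeField.plaqHol U₀ p)⁻¹ * U₀ ⟨p.src, p.μ⟩) (ζ ⟨p.src.shift p.μ, p.ν⟩) -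
                adSU2 ((GaugeField.plaqHol U₀ p)⁻¹ * U₀ ⟨p.src, p.μ⟩ * U₀ ⟨p.src.shift p.μ, p.ν⟩ * (U₀ ⟨p.src.shift p.ν, p.μ⟩)⁻¹) (ζ ⟨p.src.shift p.ν, p.μ⟩) -
                ζ ⟨p.src, p.ν⟩)) = lam (DM ζ)) ∧
          (∀ v : PBond (F.P J) 0 → EuclideanSpace ℝ (Fin 3),
            |lam v| ≤ C_lam * θBal F.L γ b₀ p₀ J * ((F.L : ℝ)⁻¹) ^ (K - J) * ∑ B : PBond (F.P J) 0, ‖v B‖) ∧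
          ∀ U ∈ fibre F ℰp J K hJK V, U ∈ histGood F ℰp (θBal F.L γ b₀ p₀) K J →
            ∑ B : PBond (F.P J) 0, ‖DM (fun ℓ => imVec (su2Quat (U ℓ * (U₀ ℓ)⁻¹))) B‖ ≤
              C_M * (((F.L : ℝ)⁻¹) ^ (K - J) * ∑ ℓ : PBond (F.P K) 0, dist1 (U ℓ * (U₀ ℓ)⁻¹) ^ 2 +
                (F.L : ℝ) ^ (K - J) * ∑ p : Plaq (F.P K) 0, (1 - reTr ((GaugeField.plaqHol U₀ p)⁻¹ * GaugeField.plaqHol U p)))) :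
    ∀ (L : ℕ), ∃ c₀ : ℝ, 0 < c₀ ∧ c₀ ≤ 1 ∧ ∀ (cw : ℝ), 0 < cw → cw ≤ c₀ → ∃ pS : ℝ, ∀ (b₀ p₀ : ℝ), 0 < b₀ → pS ≤ p₀ → 0 < p₀ → ∃ ε₁ : ℝ, 0 < ε₁ ∧ ∀ (ε₀ : ℝ), 0 < ε₀ → ε₀ ≤ ε₁ →
    ∃ γ₁ : ℝ, 0 < γ₁ ∧ ∃ C_c : ℝ, 0 ≤ C_c ∧ ∀ (F : T3Family) (γ : ℝ), F.L = L → 0 < γ → γ ≤ γ₁ →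
      ∀ (J K : ℕ) (hJK : J ≤ K) (V : GaugeField (F.P J) 0 (Matrix.specialUnitaryGroup (Fin 2) ℂ)), PlaqSmall (θBal F.L γ (cw * b₀) p₀ J) V →
        G F J V →
        ∀ U₀ ∈ {U' : GaugeField (F.P K) 0 (Matrix.specialUnitaryGroup (Fin 2) ℂ) | U' ∈ fibre F ℰp J K hJK V ∧ U' ∈ histGood F ℰp (θBal F.L γ b₀ p₀) K J ∧
            wilsonAction4 U' = minActionRegPr F J K hJK ε₀ V},
        ∀ U ∈ fibre F ℰp J K hJK V, U ∈ histGood F ℰp (θBal F.L γ b₀ p₀) K J →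
          |(∑ p : Plaq (F.P K) 0, inner ℝ (imVec (su2Quat (GaugeField.plaqHol U₀ p)))
              (adSU2 (GaugeField.plaqHol U₀ p)⁻¹ (imVec (su2Quat (U ⟨p.src, p.μ⟩ * (U₀ ⟨p.src, p.μ⟩)⁻¹))) +
                adSU2 ((GaugeField.plaqHol U₀ p)⁻¹ * U₀ ⟨p.src, p.μ⟩) (imVec (su2Quat (U ⟨p.src.shift p.μ, p.ν⟩ * (U₀ ⟨p.src.shift p.μ, p.ν⟩)⁻¹))) -
                adSU2 ((GaugeField.plaqHol U₀ p)⁻¹ * U₀ ⟨p.src, p.μ⟩ * U₀ ⟨p.src.shift p.μ, p.ν⟩ * (U₀ ⟨p.src.shift p.ν, p.μ⟩)⁻¹)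
                  (imVec (su2Quat (U ⟨p.src.shift p.ν, p.μ⟩ * (U₀ ⟨p.src.shift p.ν, p.μ⟩)⁻¹))) -
                imVec (su2Quat (U ⟨p.src, p.ν⟩ * (U₀ ⟨p.src, p.ν⟩)⁻¹))))| ≤
            C_c * θBal F.L γ b₀ p₀ J * (((F.L : ℝ)⁻¹) ^ (2 * (K - J)) * ∑ ℓ : PBond (F.P K) 0, dist1 (U ℓ * (U₀ ℓ)⁻¹) ^ 2 +
              ∑ p : Plaq (F.P K) 0, (1 - reTr ((GaugeField.plaqHol U₀ p)⁻¹ * GaugeField.plaqHol U p))) := by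
  intro L
  obtain ⟨c₀, hc₀, hc₀1, H⟩ := hMult L
  refine ⟨c₀, hc₀, hc₀1, ?_⟩
  intro cw hcw hcwle
  obtain ⟨pS, H⟩ := H cw hcw hcwle
  refine ⟨pS, ?_⟩
  intro b₀ p₀ hb hpS hp
  obtain ⟨ε₁, hε₁, H⟩ := H b₀ p₀ hb hpS hp
  refine ⟨ε₁, hε₁, ?_⟩
  intro ε₀ hε₀ hε₀le
  obtain ⟨γ₁, hγ₁, C_lam, hClam, C_M, hCM, H⟩ := H ε₀ hε₀ hε₀le
  refine ⟨min γ₁ 1, lt_min hγ₁ one_pos, C_lam * C_M, mul_nonneg hClam hCM, ?_⟩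
  intro F γ hFL hγ hγle J K hJK V hV hG U₀ hU₀ U hU hUg
  obtain ⟨DM, lam, hcrit, hlam, hM⟩ := H F γ hFL hγ (hγle.trans (min_le_left _ _)) J K hJK V hV hG U₀ hU₀
  have hMU := hM U hU hUg
  have hγ1 : γ ≤ 1 := hγle.trans (min_le_right _ _)
  have hθ0 : 0 ≤ θBal F.L γ b₀ p₀ J := (θBal_pos F.hL.2.le hγ hγ1 hb p₀ J).le
  have hL0 : (0 : ℝ) < (F.L : ℝ) := by exact_mod_cast (show 0 < F.L by have := F.hL.2; omega)
  have hN₁ : (0 : ℝ) ≤ ((F.L : ℝ)⁻¹) ^ (K - J) := pow_nonneg (inv_nonneg.mpr hL0.le) _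
  have hNN : ((F.L : ℝ)⁻¹) ^ (K - J) * (F.L : ℝ) ^ (K - J) = 1 := by
    rw [← mul_pow, inv_mul_cancel₀ hL0.ne', one_pow]
  have hN2 : ((F.L : ℝ)⁻¹) ^ (K - J) * ((F.L : ℝ)⁻¹) ^ (K - J) = ((F.L : ℝ)⁻¹) ^ (2 * (K - J)) := by rw [← pow_add, two_mul]
  have hc := hcrit (fun ℓ => imVec (su2Quat (U ℓ * (U₀ ℓ)⁻¹)))
  beta_reduce at hc
  rw [hc]
  refine (hlam _).trans ?_
  have hcoef : 0 ≤ C_lam * θBal F.L γ b₀ p₀ J * ((F.L : ℝ)⁻¹) ^ (K - J) := mul_nonneg (mul_nonneg hClam hθ0) hN₁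
  refine (mul_le_mul_of_nonneg_left hMU hcoef).trans (le_of_eq ?_)
  rw [← hN2]
  have : C_lam * θBal F.L γ b₀ p₀ J * ((F.L : ℝ)⁻¹) ^ (K - J) *
      (C_M * (((F.L : ℝ)⁻¹) ^ (K - J) * ∑ ℓ : PBond (F.P K) 0, dist1 (U ℓ * (U₀ ℓ)⁻¹) ^ 2 +
        (F.L : ℝ) ^ (K - J) * ∑ p : Plaq (F.P K) 0, (1 - reTr ((GaugeField.plaqHol U₀ p)⁻¹ * GaugeField.plaqHol U p)))) =
      C_lam * C_M * θBal F.L γ b₀ p₀ J *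
        (((F.L : ℝ)⁻¹) ^ (K - J) * ((F.L : ℝ)⁻¹) ^ (K - J) * ∑ ℓ : PBond (F.P K) 0, dist1 (U ℓ * (U₀ ℓ)⁻¹) ^ 2 +
          (((F.L : ℝ)⁻¹) ^ (K - J) * (F.L : ℝ) ^ (K - J)) * ∑ p : Plaq (F.P K) 0, (1 - reTr ((GaugeField.plaqHol U₀ p)⁻¹ * GaugeField.plaqHol U p))) := by
    ring
  rw [this, hNN, one_mul]

end Summit.QuantumFields.YangMills.Theorems.FluctuationComparisonRegPrIntLS2BetaCritPairOfMultiplier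

end
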